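import Literature.AlgebraicGeometry.NeronModels.Dilatation
import Literature.AlgebraicGeometry.Resolution.BlowupsFlatBaseChange
import HarnessLib

/-!
# Dilatations of schemes: flat base change, and the universal property for flat test schemes

Topic: `Literature/AlgebraicGeometry/NeronModels`; sequel of `Dilatation.lean` (`IsDilatation`).
Two consequences of "effective Cartier divisors pull back along flat morphisms"
(`Resolution.IsEffectiveCartier.comap_of_flat`), both PROVED:

* **Dilatations commute with flat base change** (Mayeux–Richarz–Romagny, arXiv:2001.03597, §2.5,
  Corollary: "If the morphism `X' → X` is flat and has some property `𝒫` which is stable under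
  base change, then `Bl_{Z'}^{D'} X' → Bl_Z^D X` is flat and has `𝒫`", proved there by checking
  the hypothesis of the §2.5 Lemma: "this closed subscheme is the preimage of the effective
  Cartier divisor `Bl_Z^D X ×_X D` under the flat map `p`, and hence is an effective Cartier
  divisor as well"): `IsDilatation.of_isPullback_of_flat`, `IsDilatation.pullback_snd_of_flat` —
  for `ι : S ⟶ X` flat, `X' ×_X S → S` is the dilatation of `S` in `ι⁻¹Z` along `ι⁻¹D` (so the
  comparison map of MRR (2.7) is an isomorphism and `Bl' → Bl` is a base change of `ι`).
* **The universal property for flat schemes over a base** (Bosch–Lütkebohmert–Raynaud, *Néron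
  Models*, Prop. 3.2/1 (b), in MRR's generality: `S` a scheme, `S₀ ⊆ S` an effective Cartier
  divisor — e.g. `S = Spec R`, `S₀ = Spec k` for a discrete valuation ring `R` — `X → S`,
  `D = X ×_S S₀`, `Z ⊆ D`): `isEffectiveCartier_comap_of_flat` — every FLAT `S`-scheme `T` lies in
  `Sch_X^{D-reg}` for every `S`-morphism `T → X`; hence `IsDilatation.existsUnique_of_flat` — the
  `S`-morphisms `T → X` from a flat `S`-scheme `T` whose restriction to `T₀ = T ×_S S₀` factors
  through `Z` lift uniquely to the dilatation `X'` (BLR: "for a flat `R`-scheme `T`, the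
  `R`-morphisms `T → X` whose special fibre factors through `Y` correspond to the `R`-morphisms
  `T → X'`"), and `IsDilatation.comap_le_of_flat_of_comp_eq` — conversely every `T → X'` has this
  property.

## References

* A. Mayeux, T. Richarz, M. Romagny, *Néron blowups and low-degree cohomological applications*,
  arXiv:2001.03597 (2020), §2.3 (`Sch_X^{D-reg}` is stable under flat maps), §2.5 (Lemma and
  Corollary). [MayeuxRicharzRomagny2020]
* S. Bosch, W. Lütkebohmert, M. Raynaud, *Néron Models*, Springer 1990, §3.2, Prop. 3.2/1 (b).
  [BLRNeronModels1990] (Not held; numbers only.)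
-/

noncomputable section

open CategoryTheory CategoryTheory.Limits AlgebraicGeometry TopologicalSpace
open Literature.AlgebraicGeometry.Resolution

namespace Literature.AlgebraicGeometry.NeronModels

universe u

namespace IsDilatation

variable {X' X : Scheme.{u}} {π : X' ⟶ X} {Z D : X.IdealSheafData}

/-! ## Flat base change (MRR §2.5, Corollary) -/

/-- **Dilatations commute with flat base change** (MRR §2.5, Corollary with the Lemma), for an
arbitrary cartesian square `fst ≫ π = snd ≫ ι` with `ι : S ⟶ X` flat: `snd : P ⟶ S` is the
dilatation of `S` in `ι⁻¹Z` along `ι⁻¹D` — the divisor `snd⁻¹(ι⁻¹D) = fst⁻¹(π⁻¹D)` is effective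
Cartier because `fst` (a base change of `ι`) is flat. [cite: MayeuxRicharzRomagny2020, §2.5 (Corollary)] -/
theorem of_isPullback_of_flat {P S : Scheme.{u}} {fst : P ⟶ X'} {snd : P ⟶ S} {ι : S ⟶ X}
    (H : IsPullback fst snd π ι) (h : IsDilatation π Z D) [Flat ι] :
    IsDilatation snd (Z.comap ι) (D.comap ι) := by
  haveI : Flat fst := MorphismProperty.of_isPullback H.flip ‹_›
  refine h.of_isPullback H ?_
  rw [← Scheme.IdealSheafData.comap_comp, ← H.w, Scheme.IdealSheafData.comap_comp]
  exact h.isEffectiveCartier.comap_of_flat fst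

/-- **Dilatations commute with flat base change**, for the chosen fibre product: if `π` is a
dilatation of `X` in `Z` along `D` and `ι : S ⟶ X` is flat, then `pullback.snd π ι : X' ×_X S ⟶ S`
is a dilatation of `S` in `ι⁻¹Z` along `ι⁻¹D`. [cite: MayeuxRicharzRomagny2020, §2.5 (Corollary)] -/
theorem pullback_snd_of_flat {S : Scheme.{u}} (h : IsDilatation π Z D) (ι : S ⟶ X) [Flat ι] :
    IsDilatation (pullback.snd π ι) (Z.comap ι) (D.comap ι) :=
  h.of_isPullback_of_flat (IsPullback.of_hasPullback π ι)

end IsDilatation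

/-! ## Over a base with an effective Cartier divisor: flat test schemes (BLR 3.2/1 (b)) -/

section Base

variable {S X : Scheme.{u}} {S₀ : S.IdealSheafData} (s : X ⟶ S)

/-- **Flat schemes over the base are `D`-regular** (MRR §2.3: "If `T' → T` is flat and `T → X`
is an object in this category, so is the composition"; here with `T = X ⊇ D = X ×_S S₀`,
`S₀ ⊆ S` an effective Cartier divisor): for an `S`-morphism `f : T → X` from a flat `S`-scheme
`T`, the preimage `f⁻¹D = T ×_S S₀` is an effective Cartier divisor of `T`.
[cite: MayeuxRicharzRomagny2020, §2.3] -/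
theorem isEffectiveCartier_comap_of_flat (hS₀ : IsEffectiveCartier S₀) {T : Scheme.{u}}
    (t : T ⟶ S) [Flat t] (f : T ⟶ X) (hf : f ≫ s = t) :
    IsEffectiveCartier ((S₀.comap s).comap f) := by
  rw [← Scheme.IdealSheafData.comap_comp, hf]
  exact hS₀.comap_of_flat t

variable {s} {X' : Scheme.{u}} {π : X' ⟶ X} {Z : X.IdealSheafData}

/-- **The universal property of the dilatation for flat schemes over the base**
(Bosch–Lütkebohmert–Raynaud, Prop. 3.2/1 (b): for a flat `R`-scheme `T`, the `R`-morphisms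
`T → X` whose special fibre factors through `Y` lift uniquely to the dilatation `X'` of `Y` in
`X`; Mayeux–Richarz–Romagny §2.3, Proposition, restricted to flat `S`-schemes): if `π : X' → X`
is a dilatation of `X` in `Z` along `D = X ×_S S₀`, `S₀ ⊆ S` an effective Cartier divisor, then
every `S`-morphism `f : T → X` from a flat `S`-scheme `T` whose restriction to `T ×_S S₀`
factors through `Z` factors uniquely through `π`.
[cite: MayeuxRicharzRomagny2020, §2.3 (Proposition)] -/
theorem IsDilatation.existsUnique_of_flat (hS₀ : IsEffectiveCartier S₀)
    (h : IsDilatation π Z (S₀.comap s)) {T : Scheme.{u}} (t : T ⟶ S) [Flat t] (f : T ⟶ X)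
    (hf : f ≫ s = t) (hZ : Z.comap f ≤ (S₀.comap s).comap f) :
    ∃! g : T ⟶ X', g ≫ π = f :=
  h.universal f (isEffectiveCartier_comap_of_flat s hS₀ t f hf) hZ

/-- Conversely (the points of `X'` are exactly these): an `S`-morphism `T → X` that factors
through the dilatation has restriction to `T ×_S S₀` factoring through `Z` — for every `T`, flat
or not. [cite: MayeuxRicharzRomagny2020, §2.3 (Proposition)] -/
theorem IsDilatation.comap_le_of_flat_of_comp_eq (h : IsDilatation π Z (S₀.comap s))
    {T : Scheme.{u}} {f : T ⟶ X} {g : T ⟶ X'} (hg : g ≫ π = f) :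
    Z.comap f ≤ (S₀.comap s).comap f :=
  h.comap_le_of_comp_eq hg

/-- **Flat `S`-schemes mapping to the dilatation**: for a flat `S`-scheme `T`, composition with
`π` is a bijection from the morphisms `T → X'` onto the `S`-morphisms `T → X` whose restriction to
`T ×_S S₀` factors through `Z` (BLR 3.2/1 (b), both halves). [cite: MayeuxRicharzRomagny2020, §2.3 (Proposition)] -/
theorem IsDilatation.exists_iff_of_flat (hS₀ : IsEffectiveCartier S₀)
    (h : IsDilatation π Z (S₀.comap s)) {T : Scheme.{u}} (t : T ⟶ S) [Flat t] (f : T ⟶ X)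
    (hf : f ≫ s = t) :
    (∃ g : T ⟶ X', g ≫ π = f) ↔ Z.comap f ≤ (S₀.comap s).comap f :=
  ⟨fun ⟨_, hg⟩ => h.comap_le_of_comp_eq hg,
    fun hZ => (h.existsUnique_of_flat hS₀ t f hf hZ).exists⟩

end Base

end Literature.AlgebraicGeometry.NeronModels

end
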